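import Literature.Probability.RandomPlanarGeometry.LoewnerInverseCocycle
import Literature.Probability.RandomPlanarGeometry.LoewnerMapProofs
import HarnessLib

/-!
# The hull cocycle `K_{s+u} ∖ K_s = fₛ(K^{W(s+·)}_u)` (domain Markov property of Loewner chains, deterministic part)

Trunk T-STOCH. For a continuous driving function `W` with Loewner domains `Hₜ`, hulls `Kₜ`, maps
`gₜ` and inverse maps `fₜ = gₜ⁻¹` (`LoewnerChain.lean`, `LoewnerInverse.lean`), and the shifted
driving function `W(s + ·)` (its chain is the chain "seen from time `s`"), we prove

* `Loewner.mem_domain_add_iff` — `z ∈ H_{s+u} ↔ z ∈ Hₛ ∧ gₛ(z) ∈ H^{W(s+·)}_u` (the cocycle of the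
  flow, `map_add` / `coe_add_lt_swallowingTime` of `LoewnerGrowth.lean`; Lawler (2005), Rem. 4.9,
  `g_{s+t} = g_{s,s+t} ∘ g_s`);
* `Loewner.domain_add_eq_image` — `H_{s+u} = fₛ(H^{W(s+·)}_u)`;
* `Loewner.hull_add_sdiff_eq_image` — `K_{s+u} ∖ Kₛ = fₛ(K^{W(s+·)}_u)`;
* `Loewner.domain_add_const`, `Loewner.hull_add_const'` — translation covariance
  `H^{U+a}_t = H^U_t + a`, `K^{U+a}_t = K^U_t + a` (`swallowingTime_add_const`), which rewrite
  the shifted driver `W(s + ·)` as `W(s) +` the *increments* `W(s + ·) - W(s)`: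
  `Loewner.hull_add_sdiff_eq_image_incr` — `K_{s+u} ∖ Kₛ = fₛ(K^{W(s+·)-W(s)}_u + W(s))`.

This is the deterministic half of the domain Markov property of SLE hulls (Rohde–Schramm (2005),
Prop. 2.1 (ii) / proof of Lemma 7.3, p. 910: "Conditioned on `𝓕_{t₀}`, the set
`g_{t₀}(K_{t+t₀} ∖ K_{t₀})` has the same distribution as `Kₜ + ξ(t₀)`"; the law statement then
only concerns the increments of the driving Brownian motion).

## References

* G. F. Lawler, *Conformally Invariant Processes in the Plane*, AMS (2005), Rem. 4.9, §4.1.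
* S. Rohde, O. Schramm, *Basic properties of SLE*, Ann. of Math. 161 (2005), Prop. 2.1 (ii),
  p. 910.
-/

noncomputable section

open Set Filter Topology Complex
open UpperHalfPlane (upperHalfPlaneSet isOpen_upperHalfPlaneSet)
open scoped NNReal

namespace Literature.Probability.RandomPlanarGeometry

namespace Loewner

variable {W : ℝ≥0 → ℝ} {z : ℂ}

/-- **The flow cocycle on domains**: `z ∈ H_{s+u}` iff `z ∈ Hₛ` and `gₛ(z) ∈ H^{W(s+·)}_u`.
[cite: Lawler2005, Rem. 4.9] -/
theorem mem_domain_add_iff (hW : Continuous W) (s u : ℝ≥0) :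
    z ∈ domain W (s + u) ↔ z ∈ domain W s ∧ map W s z ∈ domain (fun v ↦ W (s + v)) u := by
  constructor
  · intro hz
    have hzs : z ∈ domain W s := ⟨hz.1, fun h ↦ hz.2 (hull_mono W (le_self_add : s ≤ s + u) h)⟩
    have hT : ((s + u : ℝ≥0) : WithTop ℝ≥0) < swallowingTime W z := ((mem_domain_iff W _ z).1 hz).2
    refine ⟨hzs, (mem_domain_iff _ u _).2 ⟨mapsTo_map hW s hzs, (map_add hW hT).1⟩⟩
  · rintro ⟨hzs, hgz⟩
    exact (mem_domain_iff W _ z).2 ⟨domain_subset W s hzs,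
      coe_add_lt_swallowingTime hW hzs ((mem_domain_iff _ u _).1 hgz).2⟩

/-- **`H_{s+u} = fₛ(H^{W(s+·)}_u)`.** [cite: Lawler2005, Rem. 4.9] -/
theorem domain_add_eq_image (hW : Continuous W) (s u : ℝ≥0) :
    domain W (s + u) = loewnerInv W s '' domain (fun v ↦ W (s + v)) u := by
  ext z
  constructor
  · intro hz
    obtain ⟨hzs, hgz⟩ := (mem_domain_add_iff hW s u).1 hz
    exact ⟨map W s z, hgz, loewnerInv_map hW hzs⟩
  · rintro ⟨w, hw, rfl⟩
    have hwH : 0 < w.im := domain_subset _ u hw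
    refine (mem_domain_add_iff hW s u).2 ⟨loewnerInv_mem_domain hW s hwH, ?_⟩
    rwa [map_loewnerInv hW s hwH]

/-- **The hull cocycle `K_{s+u} ∖ Kₛ = fₛ(K^{W(s+·)}_u)`**: the hull grown between times `s` and
`s + u`, seen through `gₛ`, is the hull at time `u` of the chain driven by `W(s + ·)`.
Rohde–Schramm (2005), p. 910 (`g_{t₀}(K_{t+t₀} ∖ K_{t₀})`). [cite: RohdeSchramm2005, Prop. 2.1] -/
theorem hull_add_sdiff_eq_image (hW : Continuous W) (s u : ℝ≥0) :
    hull W (s + u) \ hull W s = loewnerInv W s '' hull (fun v ↦ W (s + v)) u := by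
  ext z
  constructor
  · rintro ⟨hzK, hzKs⟩
    have hzs : z ∈ domain W s := ⟨hzK.1, hzKs⟩
    refine ⟨map W s z, ⟨mapsTo_map hW s hzs, ?_⟩, loewnerInv_map hW hzs⟩
    -- `gₛ z ∉ H^{W(s+·)}_u`, else `z ∈ H_{s+u}`
    by_contra hlt
    rw [not_le] at hlt
    have hgz : map W s z ∈ domain (fun v ↦ W (s + v)) u :=
      (mem_domain_iff _ u _).2 ⟨mapsTo_map hW s hzs, hlt⟩
    have hz : z ∈ domain W (s + u) := (mem_domain_add_iff hW s u).2 ⟨hzs, hgz⟩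
    exact hz.2 hzK
  · rintro ⟨w, ⟨hwH, hwT⟩, rfl⟩
    have hwim : 0 < w.im := hwH
    have hzs : loewnerInv W s w ∈ domain W s := loewnerInv_mem_domain hW s hwim
    refine ⟨⟨hzs.1, ?_⟩, hzs.2⟩
    -- `fₛ w ∉ H_{s+u}` since `gₛ (fₛ w) = w ∉ H^{W(s+·)}_u`
    by_contra hlt
    rw [not_le] at hlt
    have hz : loewnerInv W s w ∈ domain W (s + u) := (mem_domain_iff W _ _).2 ⟨hzs.1, hlt⟩
    have hgw := ((mem_domain_add_iff hW s u).1 hz).2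
    rw [map_loewnerInv hW s hwim] at hgw
    exact (not_le.2 ((mem_domain_iff _ u w).1 hgw).2) hwT

/-! ### Translation covariance -/

variable {U : ℝ≥0 → ℝ}

/-- Domains of a translated driving function: `H^{U+a}_t = H^U_t + a` (`swallowingTime_add_const`).
[cite: Lawler2005, Ch. 4 §4.1] -/
theorem domain_add_const (U : ℝ≥0 → ℝ) (a : ℝ) (t : ℝ≥0) :
    domain (fun v ↦ U v + a) t = (fun z : ℂ ↦ z + a) '' domain U t := by
  ext w
  constructor
  · intro hw
    obtain ⟨hwH, hwT⟩ := (mem_domain_iff _ t w).1 hw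
    refine ⟨w - a, (mem_domain_iff U t _).2 ⟨?_, ?_⟩, by ring⟩
    · change 0 < (w - (a : ℂ)).im
      simpa using (show 0 < w.im from hwH)
    · rw [← swallowingTime_add_const U (w - a) a]
      simpa using hwT
  · rintro ⟨z, hz, rfl⟩
    obtain ⟨hzH, hzT⟩ := (mem_domain_iff U t z).1 hz
    refine (mem_domain_iff _ t _).2 ⟨?_, ?_⟩
    · change 0 < (z + (a : ℂ)).im
      simpa using (show 0 < z.im from hzH)
    · rwa [swallowingTime_add_const]

/-- Hulls of a translated driving function: `K^{U+a}_t = K^U_t + a` (the statement of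
`LoewnerSemigroup.hull_add_const`, re-proved here to keep the imports light).
[cite: Lawler2005, Ch. 4 §4.1] -/
theorem hull_add_const' (U : ℝ≥0 → ℝ) (a : ℝ) (t : ℝ≥0) :
    hull (fun v ↦ U v + a) t = (fun z : ℂ ↦ z + a) '' hull U t := by
  ext w
  constructor
  · rintro ⟨hwH, hwT⟩
    refine ⟨w - a, ⟨?_, ?_⟩, by ring⟩
    · change 0 < (w - (a : ℂ)).im
      simpa using (show 0 < w.im from hwH)
    · rw [← swallowingTime_add_const U (w - a) a]
      simpa using hwT
  · rintro ⟨z, ⟨hzH, hzT⟩, rfl⟩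
    refine ⟨?_, ?_⟩
    · change 0 < (z + (a : ℂ)).im
      simpa using (show 0 < z.im from hzH)
    · change swallowingTime (fun v ↦ U v + a) (z + a) ≤ t
      rwa [swallowingTime_add_const]

/-- The shifted driving function is the translate of its increments:
`W(s + ·) = (W(s + ·) - W(s)) + W(s)`. [folklore] -/
theorem shift_eq_incr_add (W : ℝ≥0 → ℝ) (s : ℝ≥0) :
    (fun v ↦ W (s + v)) = fun v ↦ (W (s + v) - W s) + W s := by
  funext v
  ring

/-- **The hull cocycle in terms of the increments**: `K_{s+u} ∖ Kₛ = fₛ(K^{W(s+·)-W(s)}_u + W(s))`.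
With `W = √κ B` the increments are `√κ` times a Brownian motion independent of `𝓕ₛ`, which is
the form in which the domain Markov property of SLE is used (Rohde–Schramm (2005), p. 910).
[cite: RohdeSchramm2005, Prop. 2.1] -/
theorem hull_add_sdiff_eq_image_incr (hW : Continuous W) (s u : ℝ≥0) :
    hull W (s + u) \ hull W s =
      loewnerInv W s '' ((fun z : ℂ ↦ z + (W s : ℂ)) '' hull (fun v ↦ W (s + v) - W s) u) := by
  rw [hull_add_sdiff_eq_image hW s u, shift_eq_incr_add W s, hull_add_const']

/-- `H_{s+u} = fₛ(H^{W(s+·)-W(s)}_u + W(s))`. [cite: RohdeSchramm2005, Prop. 2.1] -/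
theorem domain_add_eq_image_incr (hW : Continuous W) (s u : ℝ≥0) :
    domain W (s + u) =
      loewnerInv W s '' ((fun z : ℂ ↦ z + (W s : ℂ)) '' domain (fun v ↦ W (s + v) - W s) u) := by
  rw [domain_add_eq_image hW s u, shift_eq_incr_add W s, domain_add_const]

end Loewner

end Literature.Probability.RandomPlanarGeometry
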